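import Literature.AlgebraicGeometry.Smoothening.TorsionDrop
import Literature.RingTheory.Length.TorsionSnake
import Mathlib.RingTheory.Nakayama
import HarnessLib

/-!
# The fibre dimension of a finite module over a discrete valuation ring

Topic: `Literature/AlgebraicGeometry/Smoothening` (Bosch–Lütkebohmert–Raynaud, *Néron Models*,
§3.3: the numerics in the proof of Prop. 3.3/5). For a finite module `M` over a discrete
valuation ring `S` with uniformizer `π` and torsion submodule `T`,

  `dim_k (M/πM) = rank_S M + dim_k (T/πT)`   (`length_quotSMulTop_eq_finrank_add`),

and `dim_k (T/πT) ≥ 1` as soon as `T ≠ 0` (`one_le_length_quotSMulTop_torsion`, Nakayama). In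
the smoothening process `M = a*Ω¹_{X/R}`: the fibre dimension `dim_k (M/πM)` is the local rank
`q` of `Ω¹_{X/R}` along the centre, `rank_S M = d` is the generic rank, and `T ≠ 0` iff Néron's
measure `δ(a)` is non-zero (`NeronDefect.neronDefect_eq_zero_iff`); so at a non-smooth point
`q ≥ d + 1`, i.e. at most `N - d - 1` once-divided equations are needed and `δ` drops
(`DilatationDefect`). The first identity is the snake lemma for multiplication by `π` on
`0 → T → M → M/T → 0` (`Literature.RingTheory.Length.length_snake`). [folklore]; no named facts
(D-0026).

## References

* S. Bosch, W. Lütkebohmert, M. Raynaud, *Néron Models*, Springer 1990, §3.3, proof of Prop. 5.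
  [BLRNeronModels1990] (Not held; number only.)
-/

open scoped Pointwise
open Module Submodule Function

namespace Literature.AlgebraicGeometry.Smoothening

universe u v

variable {S : Type u} [CommRing S] [IsDomain S] [IsDiscreteValuationRing S] {π : S}
  (M : Type v) [AddCommGroup M] [Module S M] [Module.Finite S M]

/-- A finite module killed by `π` has finite length (it is a finite-dimensional `S/π`-vector
space). [folklore] -/
theorem length_ne_top_of_smul_eq_zero (hπ : Irreducible π) {Y : Type v} [AddCommGroup Y]
    [Module S Y] [Module.Finite S Y] (hY : ∀ y : Y, π • y = 0) : Module.length S Y ≠ ⊤ := by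
  obtain ⟨s, hs⟩ := Module.Finite.fg_top (R := S) (M := Y)
  have h := length_span_le_card hπ hY ((↑) : s → Y)
  rw [Subtype.range_coe_subtype, Finset.setOf_mem, hs, Module.length_top] at h
  exact ne_top_of_le_ne_top (ENat.coe_ne_top _) h

omit [IsDiscreteValuationRing S] [Module.Finite S M] in
/-- The `π`-torsion of `M` is the `π`-torsion of its torsion submodule. [folklore] -/
theorem length_torsionBy_eq_length_torsionBy_torsion (hπ0 : π ≠ 0) :
    Module.length S (torsionBy S M π) = Module.length S (torsionBy S (torsion S M) π) := by
  refine (LinearEquiv.length_eq ?_).symm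
  refine LinearEquiv.ofBijective
    ((torsion S M).subtype.restrict fun x hx => ?_) ⟨?_, ?_⟩
  · rw [mem_torsionBy_iff] at hx ⊢
    simpa using congrArg Subtype.val hx
  · intro x y hxy
    apply Subtype.ext; apply Subtype.ext
    simpa [LinearMap.restrict_apply] using congrArg Subtype.val hxy
  · rintro ⟨x, hx⟩
    rw [mem_torsionBy_iff] at hx
    have hxt : x ∈ torsion S M :=
      (mem_torsion_iff x).mpr ⟨⟨π, mem_nonZeroDivisors_of_ne_zero hπ0⟩, hx⟩
    refine ⟨⟨⟨x, hxt⟩, (mem_torsionBy_iff _ _).mpr (Subtype.ext hx)⟩, Subtype.ext rfl⟩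

omit [IsDiscreteValuationRing S] in
/-- The `π`-torsion of a torsion-free module vanishes. [folklore] -/
theorem length_torsionBy_eq_zero_of_isTorsionFree (hπ0 : π ≠ 0) {Y : Type v} [AddCommGroup Y]
    [Module S Y] [Module.IsTorsionFree S Y] : Module.length S (torsionBy S Y π) = 0 := by
  rw [Module.length_eq_zero_iff]
  refine ⟨fun x y => Subtype.ext ?_⟩
  have hreg : IsRegular π := IsRegular.of_ne_zero hπ0
  have hx := (mem_torsionBy_iff π (x : Y)).mp x.2
  have hy := (mem_torsionBy_iff π (y : Y)).mp y.2
  exact hreg.smul_right_injective Y (hx.trans hy.symm)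

/-- **The fibre dimension**: `ℓ(M/πM) = rank_S M + ℓ(T/πT)` for a finite module `M` over a
discrete valuation ring with uniformizer `π` and torsion submodule `T` (snake lemma for
multiplication by `π` on `0 → T → M → M/T → 0`; `M/T` is free of rank `rank M`). [folklore] -/
theorem length_quotSMulTop_eq_finrank_add (hπ : Irreducible π) :
    Module.length S (QuotSMulTop π M) =
      Module.finrank S M + Module.length S (QuotSMulTop π (torsion S M)) := by
  have hπ0 : π ≠ 0 := hπ.ne_zero
  have hsnake := Literature.RingTheory.Length.length_snake π (torsion S M).subtype
    (torsion S M).mkQ (torsion S M).injective_subtype (mkQ_surjective _)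
    (LinearMap.exact_subtype_mkQ _)
  -- the terms of the six-term sequence
  have h1 : Module.length S (torsionBy S (M ⧸ torsion S M) π) = 0 :=
    length_torsionBy_eq_zero_of_isTorsionFree hπ0
  have h2 : Module.length S (torsionBy S M π) = Module.length S (torsionBy S (torsion S M) π) :=
    length_torsionBy_eq_length_torsionBy_torsion M hπ0
  have h3 : Module.length S (QuotSMulTop π (M ⧸ torsion S M)) = Module.finrank S M := by
    rw [show Module.length S (QuotSMulTop π (M ⧸ torsion S M)) =
        Module.length S ((M ⧸ torsion S M) ⧸ (π • ⊤ : Submodule S (M ⧸ torsion S M))) from rfl,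
      length_quotient_smul_top_eq_finrank hπ (M ⧸ torsion S M)]
    have h := Submodule.finrank_quotient_add_finrank (torsion S M)
    have h0 : Module.finrank S (torsion S M) = 0 :=
      Module.finrank_eq_zero_iff_isTorsion.mpr (torsion_isTorsion (R := S) (M := M))
    rw [h0, add_zero] at h
    exact_mod_cast h
  have hfin : Module.length S (torsionBy S (torsion S M) π) ≠ ⊤ :=
    length_ne_top_of_smul_eq_zero hπ fun y => Subtype.ext ((mem_torsionBy_iff π (y : torsion S M)).mp y.2)
  rw [h1, h2, h3, add_zero] at hsnake
  -- `hsnake : ℓ(T[π]) + ℓ(T/π) + rank = ℓ(T[π]) + ℓ(M/π)`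
  -- `hsnake : ℓ(T[π]) + ℓ(T/π) + rank = ℓ(T[π]) + ℓ(M/π)`
  rw [add_assoc] at hsnake
  have hcancel := (WithTop.add_left_inj hfin).mp hsnake
  rw [← hcancel, add_comm]

/-- **`T/πT ≠ 0` for a non-zero finite torsion module `T`** (Nakayama), i.e.
`ℓ(T/πT) ≥ 1`. [folklore] -/
theorem one_le_length_quotSMulTop_torsion (hπ : Irreducible π) (hT : torsion S M ≠ ⊥) :
    1 ≤ Module.length S (QuotSMulTop π (torsion S M)) := by
  rw [Order.one_le_iff_ne_zero, Ne, Module.length_eq_zero_iff,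
    show Subsingleton (QuotSMulTop π (torsion S M)) ↔
      (π • ⊤ : Submodule S (torsion S M)) = ⊤ from Submodule.Quotient.subsingleton_iff]
  intro htop
  apply hT
  -- Nakayama: `T = π T` with `π` in the maximal ideal forces `T = 0`
  have hfg : (⊤ : Submodule S (torsion S M)).FG := Module.Finite.fg_top
  have hle : (⊤ : Submodule S (torsion S M)) ≤ Ideal.span {π} • ⊤ := by
    rw [Submodule.ideal_span_singleton_smul, htop]
  have hjac : Ideal.span {π} ≤ (⊥ : Ideal S).jacobson := by
    rw [← hπ.maximalIdeal_eq]
    exact IsLocalRing.maximalIdeal_le_jacobson _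
  have h := Submodule.eq_bot_of_le_smul_of_le_jacobson_bot (Ideal.span {π}) ⊤ hfg hle hjac
  rw [eq_bot_iff]
  intro x hx
  have : (⟨x, hx⟩ : torsion S M) ∈ (⊥ : Submodule S (torsion S M)) := by rw [← h]; trivial
  simpa using congrArg Subtype.val ((Submodule.mem_bot S).mp this)

/-- **At a point where the torsion is non-zero, the fibre dimension exceeds the generic rank**:
`rank_S M + 1 ≤ ℓ(M/πM)` if `T ≠ 0`. [folklore] -/
theorem finrank_add_one_le_length_quotSMulTop (hπ : Irreducible π) (hT : torsion S M ≠ ⊥) :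
    (Module.finrank S M : ℕ∞) + 1 ≤ Module.length S (QuotSMulTop π M) := by
  rw [length_quotSMulTop_eq_finrank_add M hπ]
  exact add_le_add le_rfl (one_le_length_quotSMulTop_torsion M hπ hT)

end Literature.AlgebraicGeometry.Smoothening
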